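import Summits.HodgeConjecture.Ring2.LowDimensionHodgeOfMarkmanFourfoldFactor
import HarnessLib

/-!
# The fourfold-factor cell shrinks to Moonen–Zarhin's case (g): `E_k × F` with `k` central in `End⁰(F)` and BALANCED has the product span (Prop. (3.8), §5 (5.10) Case 1 — PROVED in the tree)

Cell `pub-hodge-ring2` (HONEST FRAMING: research route conditional on HC_CM; not a corollary; Q11.4-sentence-2 already
refuted in dim ≥ 3), Literature lane (lit seat, generation 63, programme R35-E). Sequel of
`Ring2/LowDimensionHodgeOfMarkmanFourfoldFactor` (R35-D). Theorems only (no definition, no named fact, no `sorry`);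
hypotheses `hMark` (the tree's named fact `Markman2025_weilClasses_algebraic_abelianFourfold`), the row-`4` class target
`hH1 : HC(simple fourfolds not of CM type)` and Tankeev–Ribet where stated — all explicit, none discharged.

THE POINT. R35-D left, inside row `5`, the cell «`X ∼ C × F`, `C` an elliptic curve of CM type, `F` a simple non-CM fourfold
with a factor of type IV». Moonen–Zarhin's Prop. (3.8) («either `Hg(X × E) = Hg(X) × Hg(E)` or `End⁰(E) = k` … embeds into
the center of `End⁰(X)`») and its sharpening §5 (5.10) Case 1 (a central `k` acting with BALANCED multiplicities `n' = n''`
still gives the splitting) are THEOREMS of the tree (`hodgeClassesProductSpan_of_isSimple_cmCurve_of_balanced`,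
`CentreTimesCMCurveBalanced`, lit g62), so the cell
shrinks to its UNBALANCED part: «`X ∼ C × F`, `C` with complex multiplication `χ ≫ χ = -d'`, `F` a simple non-CM fourfold
carrying a CENTRAL `φ` with `φ ≫ φ = -(M²d')` and multiplicities `≠ (2,2)`» — for a simple fourfold this is `k ↪ End⁰(F)`
«acting with multiplicities `(1,3)`», i.e. EXACTLY case (g), where Thm. 0.2 (3) asserts `B•(X) = D•(X)` (in print; not in
the tree).
* §1 (reference only) the tree's `hodgeClassesProductSpan_of_isSimple_cmCurve_of_balanced` /
  `hodgeConjectureFor_prod_cmCurve_of_isSimple_of_balanced_of_hodgeConjectureFor` (`CentreTimesCMCurveBalanced`, lit g62):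
  simple `A` of any dimension, CM curve `C`, balanced central `k`-multiplications ⟹ `HC(A × C) ⟸ HC(A)`.
* §2 **`hodgeConjectureFor_of_dim_eq_five_of_markman_of_simpleFourfolds'`** — the fivefold census with residual hypotheses
  (i) simple ⟹ CM [Tankeev–Ribet], (ii) NOT case (g) in the shape above, (iii) NOT «`E² × T`, `dim_ℚ End⁰(T) = 2`» [Thm. 0.2 (1)],
  granted `hMark` and `hH1`.
* §3 the axis: **`hcUpToDim_five_iff_caseG_of_markman`** — `HCUpToDim 5 ↔ HC(simple non-CM fourfolds) ∧ HC(simple non-CM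
  fivefolds ∪ case (g) ∪ «E² × T»)`, and with Tankeev–Ribet **`hcUpToDim_five_iff_caseG_of_markman_of_tankeevRibet`**:
  modulo `hMark` and Tankeev–Ribet, the Hodge conjecture in dimension `≤ 5` is EXACTLY Moonen–Zarhin 1995 (simple fourfolds)
  + Thm. 0.2 (3) (case (g)) + Thm. 0.2 (1) (case (e) with `F = k`). On path.
* §4 (appended, R35-F) case (g) VERBATIM: on a simple fourfold «unbalanced» = «multiplicities `(1,3)`» (Shimura's positivity,
  `eigenMultiplicity_eq_one_or_eq_one_of_isSimple_of_dim_eq_four`), whence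
  **`hcUpToDim_five_iff_caseG13_of_markman_of_tankeevRibet`** with the residual cell (β) literally «`k` central in `End⁰(X₂)`
  acting with multiplicities `(1,3)`»; on path.
NOT CLAIMED: any cell decided; nothing on `D² ≠ B²`. (§§2–3 state the residual as «unbalanced»; §4 sharpens it to `(1,3)`.)

## References
* [MoonenZarhin1999LowDim] B. Moonen, Yu. Zarhin, Math. Ann. 315 (1999) 711–733: case (g), Thm. 0.2 (3)–(4), §3 (3.1), Prop. (3.8),
  §5 (5.10) Case 1 [corpus: paper:arxiv-math_9901113 p0001, p0006–p0007, p0010]. [cite: MoonenZarhin1999LowDim, Thm. 0.2 (3)–(4), §3 Prop. (3.8) and §5 (5.10)]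
* [Lombardo2016] D. Lombardo, Ann. Inst. Fourier 66 (2016), Lemma 3.4 (p. 1229). [cite: Lombardo2016, Lemma 3.4 (p. 1229)]
* [VoisinHodgeII2003] C. Voisin, *Hodge Theory and Complex Algebraic Geometry II*, proof of Prop. 9.20. [cite: VoisinHodgeII2003, proof of Prop. 9.20 (first display)]
* [Tankeev1983] S. G. Tankeev, Math. USSR Izv. 20 (1983). [cite: Tankeev1983, main theorem]
* [Shimura1963AnalyticFamilies] G. Shimura, Ann. of Math. 78 (1963), §4 Prop. 14 (positivity of multiplicities).
  [cite: Shimura1963AnalyticFamilies, §4 Prop. 14]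
* [Markman2025SurveySecant] E. Markman, arXiv:2509.23403, Thm. 1.2 and Cor. 1.3. [claim: Markman2025SurveySecant, status: under-review]
* [Deligne2000] P. Deligne, *The Hodge conjecture* (Clay, 2000), §1. [cite: Deligne2000, §1]
-/

noncomputable section

open CategoryTheory CategoryTheory.Limits

namespace Summit.HodgeConjecture.Ring2.LowDimOfMarkman

open Literature.AlgebraicGeometry.Motives (AbelianVariety)
open Literature.AlgebraicGeometry.Motives.AbelianVariety
open Literature.AlgebraicGeometry.HodgeTheory
open Literature.AlgebraicGeometry.ComplexMultiplication
open Literature.AlgebraicGeometry.Milne1999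
open Summit.HodgeConjecture.CorCM.Domination
open Summit.HodgeConjecture.CorCM.CMWeights (hodgeConjectureFor_of_isOfCMType_dim_le_five_of_markman)
open Summit.HodgeConjecture.HodgeConjecture.Ring2.ClassTargets

variable {X A C F : AbelianVariety ℂ}

/-! ### §1 (reference) Prop. (3.8) / (5.10) Case 1 is the tree's `CentreTimesCMCurveBalanced`

The splitting for a SIMPLE `A` (any dimension) with balanced central `k`-multiplications times the CM curve `E_k` is ALREADY a
theorem of the tree: `Literature.AlgebraicGeometry.HodgeTheory.hodgeClassesProductSpan_of_isSimple_cmCurve_of_balanced` and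
`hodgeConjectureFor_prod_cmCurve_of_isSimple_of_balanced_of_hodgeConjectureFor` (lit g62, `CentreTimesCMCurveBalanced`); they
are used below BY NAME (no copy). -/

/-! ### §2 The fivefold census with the residual cell in the shape of case (g) -/

/-- **THE FIVEFOLD CENSUS GRANTED MARKMAN AND THE ROW-`4` CELL, RESIDUAL = case (g) ∪ Thm. 0.2 (1) ∪ simple non-CM.** For a
fivefold `X`, granted `hMark` and `hH1 : HC(simple non-CM fourfolds)`: if (i) `X` simple ⟹ `X` of CM type, (ii) `X` is NOT
`∼ C × F` with `C` an elliptic curve, `χ ≫ χ = -d'` on `C`, `F` a simple fourfold not of CM type carrying a CENTRAL `φ` with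
`φ ≫ φ = -(M²d')`, `M > 0`, of UNBALANCED multiplicities (case (g): «`k ↪ End⁰(X₂)` acting with multiplicities `(1,3)`»), and
(iii) `X` is NOT `∼ E² × T` with `dim_ℚ End⁰(T) = 2`, then HC holds for `X`. Proof: R35-B/R35-D dispatch everything except a
simple non-CM fourfold factor `F` with `X ∼ F × C`; then `HC(F)` is `hH1`, and `HC(F × C)` follows from §1 (balanced or no
embedding) or from R35-D §1 (`C` not of CM type). [cite: MoonenZarhin1999LowDim, Thm. 0.2 (3)–(4), §3 Prop. (3.8) and §5 (5.10)]
[claim: Markman2025SurveySecant, status: under-review] -/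
theorem hodgeConjectureFor_of_dim_eq_five_of_markman_of_simpleFourfolds'
    (hMark : Markman2025_weilClasses_algebraic_abelianFourfold)
    (hH1 : HCOnClass fun A => A.dim = 4 ∧ A.IsSimple ∧ ¬ IsOfCMType A) (hX5 : X.dim = 5)
    (hs : X.IsSimple → IsOfCMType X)
    (hg : ¬ ∃ (C F : AbelianVariety ℂ) (χ : C ⟶ C) (d' : ℕ) (φ : F ⟶ F) (M : ℕ), C.dim = 1 ∧ 0 < d' ∧
      χ ≫ χ = -(d' • 𝟙 C) ∧ F.IsSimple ∧ F.dim = 4 ∧ ¬ IsOfCMType F ∧ 0 < M ∧ φ ≫ φ = -((M * M * d') • 𝟙 F) ∧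
      AbelianVariety.endAlgebra.of F φ ∈ Subalgebra.center ℚ F.endAlgebra ∧
      eigenMultiplicity F φ (Complex.I * (Real.sqrt (M * M * d' : ℕ) : ℂ)) ≠
        eigenMultiplicity F φ (-(Complex.I * (Real.sqrt (M * M * d' : ℕ) : ℂ))) ∧
      AbelianVariety.IsIsogenous X (C.prod F))
    (hne : ¬ ∃ E T : AbelianVariety ℂ, E.dim = 1 ∧ IsOfCMType E ∧ T.IsSimple ∧ T.dim = 3 ∧
      Module.finrank ℚ T.endAlgebra = 2 ∧ Nonempty (E.endAlgebra →+* T.endAlgebra) ∧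
      AbelianVariety.IsIsogenous X (E.prod (E.prod T))) :
    HodgeConjectureFor X.dim X.X := by
  by_cases hF : ∃ F : AbelianVariety ℂ, F.IsSimple ∧ F.dim = 4 ∧ ¬ IsOfCMType F ∧ AVDominatedBy F X
  · obtain ⟨F, hFs, hF4, hFcm, hFX⟩ := hF
    obtain ⟨C, hdim, hFC⟩ := exists_prod_isIsogenous_of_avDominatedBy hFX
    have hC : C.dim = 1 := by omega
    have hHF : HodgeConjectureFor F.dim F.X := hH1 F ⟨hF4, hFs, hFcm⟩
    refine HodgeConjectureFor.of_isIsogenous hFC.symm' ?_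
    by_cases hCcm : IsOfCMType C
    · -- `C = E_k`: balanced (or no) central `k` in `End⁰(F)`, else case (g) is excluded by `hg`
      obtain ⟨χ, d', hd', hχ⟩ := exists_hom_comp_self_eq_neg_of_cmCurve hC hCcm
      refine hodgeConjectureFor_prod_cmCurve_of_isSimple_of_balanced_of_hodgeConjectureFor hFs (by omega) hC χ hd' hχ
        (fun φ M hM hφ hz => ?_) hHF
      by_contra hne'
      exact hg ⟨C, F, χ, d', φ, M, hC, hd', hχ, hFs, hF4, hFcm, hM, hφ, hz, hne',
        hFC.symm'.trans (isIsogenous_prod_comm F C)⟩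
    · exact hodgeConjectureFor_simple_prod_curve_of_hodgeConjectureFor hFs (by omega) hC (Or.inl hCcm) hHF
  · push Not at hF
    exact hodgeConjectureFor_of_dim_eq_five_of_markman hMark hX5 hs
      (fun F hFs hF4 hFX => by_contra fun hFcm => hF F hFs hF4 hFcm hFX) hne

/-! ### §3 The axis: `HCUpToDim 5` modulo Markman is Moonen–Zarhin 1995 + case (g) + Thm. 0.2 (1) (+ Tankeev–Ribet) -/

/-- **`HCUpToDim 5` modulo Markman, residual in the shape of the printed rows**:
`HCUpToDim 5 ↔ HC(simple non-CM fourfolds) ∧ HC(simple non-CM fivefolds ∪ case (g) ∪ «E² × T, dim_ℚ End⁰(T) = 2»)`.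
[cite: MoonenZarhin1999LowDim, Thm. 0.1, Thm. 0.2 (1), (3)] [claim: Markman2025SurveySecant, status: under-review] -/
theorem hcUpToDim_five_iff_caseG_of_markman (hMark : Markman2025_weilClasses_algebraic_abelianFourfold) :
    HCUpToDim 5 ↔ (HCOnClass fun A => A.dim = 4 ∧ A.IsSimple ∧ ¬ IsOfCMType A) ∧
      HCOnClass fun A => A.dim = 5 ∧ ((A.IsSimple ∧ ¬ IsOfCMType A) ∨
        (∃ (C F : AbelianVariety ℂ) (χ : C ⟶ C) (d' : ℕ) (φ : F ⟶ F) (M : ℕ), C.dim = 1 ∧ 0 < d' ∧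
          χ ≫ χ = -(d' • 𝟙 C) ∧ F.IsSimple ∧ F.dim = 4 ∧ ¬ IsOfCMType F ∧ 0 < M ∧ φ ≫ φ = -((M * M * d') • 𝟙 F) ∧
          AbelianVariety.endAlgebra.of F φ ∈ Subalgebra.center ℚ F.endAlgebra ∧
          eigenMultiplicity F φ (Complex.I * (Real.sqrt (M * M * d' : ℕ) : ℂ)) ≠
            eigenMultiplicity F φ (-(Complex.I * (Real.sqrt (M * M * d' : ℕ) : ℂ))) ∧
          AbelianVariety.IsIsogenous A (C.prod F)) ∨
        (∃ E T : AbelianVariety ℂ, E.dim = 1 ∧ IsOfCMType E ∧ T.IsSimple ∧ T.dim = 3 ∧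
          Module.finrank ℚ T.endAlgebra = 2 ∧ Nonempty (E.endAlgebra →+* T.endAlgebra) ∧
          AbelianVariety.IsIsogenous A (E.prod (E.prod T)))) := by
  rw [hcUpToDim_succ_iff 4, hcUpToDim_succ_iff 3, hcAtDim_four_iff_simple_nonCM_of_markman hMark]
  constructor
  · rintro ⟨⟨-, h4⟩, h5⟩
    exact ⟨h4, hcOnClass_mono (fun A hA => hA.1) h5⟩
  · rintro ⟨h4, h5⟩
    refine ⟨⟨hcUpToDim_three, h4⟩, fun A hA5 => ?_⟩
    by_cases h1 : A.IsSimple ∧ ¬ IsOfCMType A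
    · exact h5 A ⟨hA5, Or.inl h1⟩
    by_cases h2 : ∃ (C F : AbelianVariety ℂ) (χ : C ⟶ C) (d' : ℕ) (φ : F ⟶ F) (M : ℕ), C.dim = 1 ∧ 0 < d' ∧
        χ ≫ χ = -(d' • 𝟙 C) ∧ F.IsSimple ∧ F.dim = 4 ∧ ¬ IsOfCMType F ∧ 0 < M ∧ φ ≫ φ = -((M * M * d') • 𝟙 F) ∧
        AbelianVariety.endAlgebra.of F φ ∈ Subalgebra.center ℚ F.endAlgebra ∧
        eigenMultiplicity F φ (Complex.I * (Real.sqrt (M * M * d' : ℕ) : ℂ)) ≠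
          eigenMultiplicity F φ (-(Complex.I * (Real.sqrt (M * M * d' : ℕ) : ℂ))) ∧
        AbelianVariety.IsIsogenous A (C.prod F)
    · exact h5 A ⟨hA5, Or.inr (Or.inl h2)⟩
    by_cases h3 : ∃ E T : AbelianVariety ℂ, E.dim = 1 ∧ IsOfCMType E ∧ T.IsSimple ∧ T.dim = 3 ∧
        Module.finrank ℚ T.endAlgebra = 2 ∧ Nonempty (E.endAlgebra →+* T.endAlgebra) ∧
        AbelianVariety.IsIsogenous A (E.prod (E.prod T))
    · exact h5 A ⟨hA5, Or.inr (Or.inr h3)⟩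
    exact hodgeConjectureFor_of_dim_eq_five_of_markman_of_simpleFourfolds' hMark h4 hA5
      (fun hs => by_contra fun hcm => h1 ⟨hs, hcm⟩) h2 h3

/-- **… and granted Tankeev–Ribet**: `HCUpToDim 5 ↔ HC(simple non-CM fourfolds) ∧ HC(case (g) ∪ «E² × T, dim_ℚ End⁰(T) = 2»)`
— MODULO MARKMAN'S FOURFOLD THEOREM AND TANKEEV–RIBET, THE HODGE CONJECTURE IN DIMENSION `≤ 5` IS EQUIVALENT TO THE HODGE
CONJECTURE ON THREE PRINTED ROWS: Moonen–Zarhin 1995 (simple fourfolds not of CM type), Moonen–Zarhin 1999 Thm. 0.2 (3) (case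
(g), `B = D` in print) and Thm. 0.2 (1) (case (e) with `End⁰(X₂) = k`). [cite: MoonenZarhin1999LowDim, Thm. 0.1, Thm. 0.2 (1), (3) and §2 Thm. (2.7)]
[cite: Tankeev1983, main theorem] [claim: Markman2025SurveySecant, status: under-review] -/
theorem hcUpToDim_five_iff_caseG_of_markman_of_tankeevRibet (hMark : Markman2025_weilClasses_algebraic_abelianFourfold)
    (hTR : TankeevRibet1983_hodgeClasses_divisorial_powers_simplePrimeDimension) :
    HCUpToDim 5 ↔ (HCOnClass fun A => A.dim = 4 ∧ A.IsSimple ∧ ¬ IsOfCMType A) ∧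
      HCOnClass fun A => A.dim = 5 ∧
        ((∃ (C F : AbelianVariety ℂ) (χ : C ⟶ C) (d' : ℕ) (φ : F ⟶ F) (M : ℕ), C.dim = 1 ∧ 0 < d' ∧
          χ ≫ χ = -(d' • 𝟙 C) ∧ F.IsSimple ∧ F.dim = 4 ∧ ¬ IsOfCMType F ∧ 0 < M ∧ φ ≫ φ = -((M * M * d') • 𝟙 F) ∧
          AbelianVariety.endAlgebra.of F φ ∈ Subalgebra.center ℚ F.endAlgebra ∧
          eigenMultiplicity F φ (Complex.I * (Real.sqrt (M * M * d' : ℕ) : ℂ)) ≠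
            eigenMultiplicity F φ (-(Complex.I * (Real.sqrt (M * M * d' : ℕ) : ℂ))) ∧
          AbelianVariety.IsIsogenous A (C.prod F)) ∨
        (∃ E T : AbelianVariety ℂ, E.dim = 1 ∧ IsOfCMType E ∧ T.IsSimple ∧ T.dim = 3 ∧
          Module.finrank ℚ T.endAlgebra = 2 ∧ Nonempty (E.endAlgebra →+* T.endAlgebra) ∧
          AbelianVariety.IsIsogenous A (E.prod (E.prod T)))) := by
  rw [hcUpToDim_five_iff_caseG_of_markman hMark]
  refine and_congr_right fun _ => ⟨fun h => hcOnClass_mono (fun A hA => ⟨hA.1, Or.inr hA.2⟩) h, fun h A hA => ?_⟩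
  rcases hA.2 with hs | hrest
  · exact hcOnClass_simple_primeDim_of_tankeevRibet hTR A ⟨hs.1, by rw [hA.1]; norm_num⟩
  · exact h A ⟨hA.1, hrest⟩

/-- **On path**: every cell is a case of the summit. [cite: Deligne2000, §1] -/
theorem caseGResidualCells_of_hodgeConjecture (h : _root_.HodgeConjecture) :
    (HCOnClass fun A => A.dim = 4 ∧ A.IsSimple ∧ ¬ IsOfCMType A) ∧
      HCOnClass fun A => A.dim = 5 ∧
        ((∃ (C F : AbelianVariety ℂ) (χ : C ⟶ C) (d' : ℕ) (φ : F ⟶ F) (M : ℕ), C.dim = 1 ∧ 0 < d' ∧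
          χ ≫ χ = -(d' • 𝟙 C) ∧ F.IsSimple ∧ F.dim = 4 ∧ ¬ IsOfCMType F ∧ 0 < M ∧ φ ≫ φ = -((M * M * d') • 𝟙 F) ∧
          AbelianVariety.endAlgebra.of F φ ∈ Subalgebra.center ℚ F.endAlgebra ∧
          eigenMultiplicity F φ (Complex.I * (Real.sqrt (M * M * d' : ℕ) : ℂ)) ≠
            eigenMultiplicity F φ (-(Complex.I * (Real.sqrt (M * M * d' : ℕ) : ℂ))) ∧
          AbelianVariety.IsIsogenous A (C.prod F)) ∨
        (∃ E T : AbelianVariety ℂ, E.dim = 1 ∧ IsOfCMType E ∧ T.IsSimple ∧ T.dim = 3 ∧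
          Module.finrank ℚ T.endAlgebra = 2 ∧ Nonempty (E.endAlgebra →+* T.endAlgebra) ∧
          AbelianVariety.IsIsogenous A (E.prod (E.prod T)))) :=
  ⟨hcOnClass_of_hodgeConjecture _ h, hcOnClass_of_hodgeConjecture _ h⟩

/-! ### §4 The residual in the PRINTED shape of case (g): multiplicities `(1,3)` (appended, R35-F) -/

/-- **On a simple abelian fourfold an unbalanced complex multiplication has multiplicities `(1,3)` or `(3,1)`**: for
`φ ≫ φ = -d` (`d > 0`) on a simple `F` of dimension `4`, both multiplicities of `φ` on `H^{1,0}(F)` are positive (Shimura's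
Prop. 14, the tree's `AbelianVariety.eigenMultiplicity_pos_of_isSimple`) and sum to `4`
(`eigenMultiplicity_add_eigenMultiplicity_neg_eq_dim`), so `≠ (2,2)` means `1` at one of the two eigenvalues — Moonen–Zarhin's
«`k` acts on `T_{X₂,0}` with multiplicities `(1,3)`». [cite: MoonenZarhin1999LowDim, §2 (2.3) and case (g)]
[cite: Shimura1963AnalyticFamilies, §4 Prop. 14] -/
theorem eigenMultiplicity_eq_one_or_eq_one_of_isSimple_of_dim_eq_four (hFs : F.IsSimple) (hF4 : F.dim = 4) (φ : F ⟶ F)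
    {d : ℕ} (hd : 0 < d) (hφ : φ ≫ φ = -(d • 𝟙 F))
    (hne : eigenMultiplicity F φ (Complex.I * (Real.sqrt d : ℂ)) ≠ eigenMultiplicity F φ (-(Complex.I * (Real.sqrt d : ℂ)))) :
    eigenMultiplicity F φ (Complex.I * (Real.sqrt d : ℂ)) = 1 ∨
      eigenMultiplicity F φ (-(Complex.I * (Real.sqrt d : ℂ))) = 1 := by
  have hsum := eigenMultiplicity_add_eigenMultiplicity_neg_eq_dim F φ hd hφ
  obtain ⟨ha, hb⟩ := AbelianVariety.eigenMultiplicity_pos_of_isSimple F hFs φ hd hφ (by omega)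
  omega

/-- Conversely, multiplicity `1` at one eigenvalue is unbalanced on a fourfold (`1 + 3 = 4`).
[cite: MoonenZarhin1999LowDim, §2 (2.3)] -/
theorem eigenMultiplicity_ne_of_eq_one_of_dim_eq_four (hF4 : F.dim = 4) (φ : F ⟶ F) {d : ℕ} (hd : 0 < d)
    (hφ : φ ≫ φ = -(d • 𝟙 F))
    (h1 : eigenMultiplicity F φ (Complex.I * (Real.sqrt d : ℂ)) = 1 ∨
      eigenMultiplicity F φ (-(Complex.I * (Real.sqrt d : ℂ))) = 1) :
    eigenMultiplicity F φ (Complex.I * (Real.sqrt d : ℂ)) ≠ eigenMultiplicity F φ (-(Complex.I * (Real.sqrt d : ℂ))) := by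
  have hsum := eigenMultiplicity_add_eigenMultiplicity_neg_eq_dim F φ hd hφ
  omega

/-- **`HCUpToDim 5` MODULO MARKMAN AND TANKEEV–RIBET, WITH CASE (g) VERBATIM**: the Hodge conjecture for all complex abelian
varieties of dimension `≤ 5` is equivalent — granted the tree's named facts `Markman2025_weilClasses_algebraic_abelianFourfold`
and `TankeevRibet1983_hodgeClasses_divisorial_powers_simplePrimeDimension`, both hypotheses — to the Hodge conjecture on
(α) the simple fourfolds not of CM type [Moonen–Zarhin 1995], together with (β) the fivefolds `X ∼ X₁ × X₂`, `X₁` an elliptic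
curve with complex multiplication `χ ≫ χ = -d'`, `X₂` a simple fourfold not of CM type with a CENTRAL `φ`, `φ ≫ φ = -(M²d')`,
acting on `H^{1,0}(X₂)` with multiplicities `(1,3)` — case (g) [Thm. 0.2 (3): `B•(X) = D•(X)` in print] — and (γ) the
fivefolds `X ∼ X₁² × X₂`, `X₂` a simple threefold with `dim_ℚ End⁰(X₂) = 2 = dim_ℚ End⁰(X₁)`, `End⁰(X₁) ↪ End⁰(X₂)` — case (e)
∩ (a1) [Thm. 0.2 (1)]. [cite: MoonenZarhin1999LowDim, Thm. 0.1, Thm. 0.2 (1), (3) with cases (e), (g), and §2 Thm. (2.7)]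
[cite: Tankeev1983, main theorem] [claim: Markman2025SurveySecant, status: under-review] -/
theorem hcUpToDim_five_iff_caseG13_of_markman_of_tankeevRibet (hMark : Markman2025_weilClasses_algebraic_abelianFourfold)
    (hTR : TankeevRibet1983_hodgeClasses_divisorial_powers_simplePrimeDimension) :
    HCUpToDim 5 ↔ (HCOnClass fun A => A.dim = 4 ∧ A.IsSimple ∧ ¬ IsOfCMType A) ∧
      HCOnClass fun A => A.dim = 5 ∧
        ((∃ (C F : AbelianVariety ℂ) (χ : C ⟶ C) (d' : ℕ) (φ : F ⟶ F) (M : ℕ), C.dim = 1 ∧ 0 < d' ∧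
          χ ≫ χ = -(d' • 𝟙 C) ∧ F.IsSimple ∧ F.dim = 4 ∧ ¬ IsOfCMType F ∧ 0 < M ∧ φ ≫ φ = -((M * M * d') • 𝟙 F) ∧
          AbelianVariety.endAlgebra.of F φ ∈ Subalgebra.center ℚ F.endAlgebra ∧
          (eigenMultiplicity F φ (Complex.I * (Real.sqrt (M * M * d' : ℕ) : ℂ)) = 1 ∨
            eigenMultiplicity F φ (-(Complex.I * (Real.sqrt (M * M * d' : ℕ) : ℂ))) = 1) ∧
          AbelianVariety.IsIsogenous A (C.prod F)) ∨
        (∃ E T : AbelianVariety ℂ, E.dim = 1 ∧ IsOfCMType E ∧ T.IsSimple ∧ T.dim = 3 ∧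
          Module.finrank ℚ T.endAlgebra = 2 ∧ Nonempty (E.endAlgebra →+* T.endAlgebra) ∧
          AbelianVariety.IsIsogenous A (E.prod (E.prod T)))) := by
  rw [hcUpToDim_five_iff_caseG_of_markman_of_tankeevRibet hMark hTR]
  refine and_congr_right fun _ => ⟨fun h => hcOnClass_mono (fun A hA => ⟨hA.1, ?_⟩) h,
    fun h => hcOnClass_mono (fun A hA => ⟨hA.1, ?_⟩) h⟩
  · rcases hA.2 with ⟨C, F, χ, d', φ, M, hC, hd', hχ, hFs, hF4, hFcm, hM, hφ, hz, h1, hiso⟩ | he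
    · exact Or.inl ⟨C, F, χ, d', φ, M, hC, hd', hχ, hFs, hF4, hFcm, hM, hφ, hz,
        eigenMultiplicity_ne_of_eq_one_of_dim_eq_four hF4 φ (Nat.mul_pos (Nat.mul_pos hM hM) hd') hφ h1, hiso⟩
    · exact Or.inr he
  · rcases hA.2 with ⟨C, F, χ, d', φ, M, hC, hd', hχ, hFs, hF4, hFcm, hM, hφ, hz, hne, hiso⟩ | he
    · exact Or.inl ⟨C, F, χ, d', φ, M, hC, hd', hχ, hFs, hF4, hFcm, hM, hφ, hz,
        eigenMultiplicity_eq_one_or_eq_one_of_isSimple_of_dim_eq_four hFs hF4 φ (Nat.mul_pos (Nat.mul_pos hM hM) hd') hφ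
          hne, hiso⟩
    · exact Or.inr he

/-- **On path** for the `(1,3)` cells. [cite: Deligne2000, §1] -/
theorem caseG13ResidualCells_of_hodgeConjecture (h : _root_.HodgeConjecture) :
    (HCOnClass fun A => A.dim = 4 ∧ A.IsSimple ∧ ¬ IsOfCMType A) ∧
      HCOnClass fun A => A.dim = 5 ∧
        ((∃ (C F : AbelianVariety ℂ) (χ : C ⟶ C) (d' : ℕ) (φ : F ⟶ F) (M : ℕ), C.dim = 1 ∧ 0 < d' ∧
          χ ≫ χ = -(d' • 𝟙 C) ∧ F.IsSimple ∧ F.dim = 4 ∧ ¬ IsOfCMType F ∧ 0 < M ∧ φ ≫ φ = -((M * M * d') • 𝟙 F) ∧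
          AbelianVariety.endAlgebra.of F φ ∈ Subalgebra.center ℚ F.endAlgebra ∧
          (eigenMultiplicity F φ (Complex.I * (Real.sqrt (M * M * d' : ℕ) : ℂ)) = 1 ∨
            eigenMultiplicity F φ (-(Complex.I * (Real.sqrt (M * M * d' : ℕ) : ℂ))) = 1) ∧
          AbelianVariety.IsIsogenous A (C.prod F)) ∨
        (∃ E T : AbelianVariety ℂ, E.dim = 1 ∧ IsOfCMType E ∧ T.IsSimple ∧ T.dim = 3 ∧
          Module.finrank ℚ T.endAlgebra = 2 ∧ Nonempty (E.endAlgebra →+* T.endAlgebra) ∧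
          AbelianVariety.IsIsogenous A (E.prod (E.prod T)))) :=
  ⟨hcOnClass_of_hodgeConjecture _ h, hcOnClass_of_hodgeConjecture _ h⟩

end Summit.HodgeConjecture.Ring2.LowDimOfMarkman

end
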